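import Literature.AlgebraicGeometry.Motives.HodgeThetaAnnihilatorPerfectTimesAbelian
import Literature.AlgebraicGeometry.Motives.HodgeThetaSubalgebraReductive
import Literature.AlgebraicGeometry.Motives.SpanCRationalRadicalDescent
import HarnessLib

/-!
# The Hodge operator lies in the complexified DERIVED algebra of every admissible `𝔤 ∋_ℂ Θ` as soon as `Θ` is trace-orthogonal to the centre; hence rational tensors on `V₁ ⊕ V₂` killed by `Θ` are killed by `Θ₁ ⊕ 0` whenever `V₁` satisfies the `Θ`-trace condition and the commutant on `V₂` is abelian (Lombardo 2016 Lemma 3.2/3.4 with `H(A)` SEMISIMPLE — the Lie step beyond «no factor of type IV», covering abelian varieties of Weil type)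

Family `hodge`, layer `Literature/AlgebraicGeometry/Motives` (abstract polarizable `ℚ`-Hodge structures; no geometry). Written for the cell `pub-hodge-ring2` (HONEST FRAMING: research route conditional on HC_CM; not a corollary; Q11.4-sentence-2 already refuted in dim ≥ 3), seat `motiv`
(gen 138; offered to LEAD as `F-motiv-g138-1`, placed here by the cell's LEAN PLACEMENT RULE: printed results with cite tags).
UNCONDITIONAL linear algebra / Hodge theory of complex abelian varieties; theorems and ONE predicate `ThetaTraceCondition` (a definition, nothing asserted); no named fact, nothing admitted;
no step towards a summit statement beyond the printed results it formalizes (HC_CM, where it occurs, is a HYPOTHESIS).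

PRINTED RESULTS, Lie-algebra form.
* D. Lombardo, Ann. Inst. Fourier 66 (2016), Lemma 3.2 / Lemma 3.4 (p. 1229; arXiv:1402.1478 Lemmas 32/35): for `B`
  of CM type and `A` with `H(A)` SEMISIMPLE, `H(A × B)^{der} ↠ H(A)^{der} = H(A)`, so `H(A × B) ≅ H(A) × H(B)`.
* B. Moonen, Yu. Zarhin, Duke Math. J. 77 (1995) / Math. Ann. 315 (1999) §1, and *Weil classes on abelian
  varieties*, Crelle 496 (1998) §1 Remark (1) after Criterion (2): `Hdg(X)` is semisimple iff the space of Weil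
  classes `W_{F′}` consists of Hodge classes (`F′ ⊇` the centre `E` of `End⁰ X`), iff the multiplicities are
  balanced, `n_σ = n_σ̄` — in Lie form: the Hodge operator `Θ` has no component in the centre of `Lie Hg`, i.e.
  `tr(Θ ∘ a) = 0` for every central (`ψ`-skew) Hodge endomorphism `a`.
* P. Deligne, LNM 900 (1982), I Prop. 3.6: `MT(V, h)` is reductive (non-degenerate trace form by positivity).

THIS FILE. Let `H` be an effective polarizable `ℚ`-Hodge structure of weight `1` on `V`, `ψ` a polarization, `Θ`
the Hodge operator, `𝔤 ⊆ End_ℚ(V)` ANY bracket-closed rational subspace of `ψ`-skew operators with `Θ ∈ 𝔤_ℂ`,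
`𝔷(𝔤)` its centre and `𝔡(𝔤) = span_ℚ {XY - YX}` its derived algebra (spelled out; `HodgeThetaSubalgebraReductive`:
`𝔤 = 𝔷(𝔤) ⊕ 𝔡(𝔤)`).
* §1 **`theta_mem_spanC_derived_of_forall_central_trace_eq_zero`** — if `tr(Θ ∘ Z_ℂ) = 0` for every `Z ∈ 𝔷(𝔤)`,
  then `Θ ∈ 𝔡(𝔤)_ℂ`. Proof: write `Θ = z + s` along `𝔤_ℂ = 𝔷_ℂ + 𝔡_ℂ`; `tr(s Z'_ℂ) = 0` for `Z' ∈ 𝔷`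
  (`tr([X,Y] Z') = tr(X [Y,Z']) = 0`), so `tr(z Z'_ℂ) = 0` for all `Z' ∈ 𝔷`; if `z ≠ 0`, descent of radicals
  (`spanC_exists_rational_radical`) yields a rational `X ∈ 𝔷`, `X ≠ 0`, trace-orthogonal to `𝔷_ℂ ∋ X_ℂ`, so
  `tr(X²) = 0`, contradicting `tr(X²) < 0` on the centre (`trace_mul_self_lt_zero_of_central`, Hodge–Riemann).
  Variant `…_of_forall_central_hodge_trace_eq_zero`: the hypothesis on the `ψ`-skew CENTRAL HODGE ENDOMORPHISMS of
  `V` (the centre of `𝔤` consists of such, `mem_endAlg_and_commute_of_mem_center`), and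
  `forall_central_hodge_trace_eq_zero_of_forall_central_skew_eq_zero`: «no type IV» (`hE`: they all vanish) is the
  special case where the hypothesis is vacuous. **`ThetaTraceCondition H`** packages the hypothesis as a predicate
  (`thetaTraceCondition_of_forall_central_skew_eq_zero`: «no type IV» implies it).
* §2 **`exists_lie_wordDerAt_incl_proj_eq_zero_of_thetaTrace_times_abelian`** — the product Lie step of
  `HodgeThetaAnnihilatorPerfectTimesAbelian` with its hypothesis `hE₁` («every `ψ₁`-skew central Hodge endomorphism
  of `V₁` vanishes», abelian varieties without factor of type IV) REPLACED by the `Θ`-trace condition on `V₁`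
  («`Hg(A)` semisimple»: abelian varieties of Weil type with balanced signature included): the rational `Θ_U`-killed
  coefficient tensors `q` on `U = V₁ ⊕ V₂` are killed by `ι₁ Y π₁` for every `Y ∈ 𝔡(𝔤₁)_ℂ`, `𝔤₁` the corner algebra
  of the rational annihilator, and `Θ₁ ∈ 𝔡(𝔤₁)_ℂ` (§1) — in particular (**`wordDerAt_incl_theta_proj_eq_zero_of_
  thetaTrace_times_abelian`**) by `ι₁ Θ₁ π₁`, which is the ONLY instance the geometric consumer
  (`HodgeTheory/NoTypeIVTimesCMInvariance`, l. 410, `Y := Θ_A`) uses. Proof = the R5 proof verbatim up to the corner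
  algebra; new last step `Θ₁ ∈ 𝔡(𝔤₁)_ℂ` instead of `𝔤₁ = 𝔡(𝔤₁)`.

## References

* [Lombardo2016] D. Lombardo, Ann. Inst. Fourier 66 (2016), Lemma 3.2, Lemma 3.4 (p. 1229). [cite: Lombardo2016, Lemma 3.4 (p. 1229)]
* [MoonenZarhin1998WeilClasses] B. Moonen, Yu. Zarhin, *Weil classes on abelian varieties*, J. reine angew. Math.
  496 (1998), §1 Criterion and Remark (1). [cite: MoonenZarhin1998WeilClasses, §1 Remark (1) after Criterion (2)]
* [MoonenZarhin1999LowDim] B. Moonen, Yu. Zarhin, Math. Ann. 315 (1999), §1, §3 (3.1). [cite: MoonenZarhin1999LowDim, §1]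
* [Deligne1982HodgeCycles] P. Deligne, LNM 900 (1982), I §3 Prop. 3.4, Prop. 3.6. [cite: Deligne1982HodgeCycles, I §3 Prop. 3.6]
* [Humphreys1972] J. E. Humphreys, GTM 9, §5.1, §19.1. [cite: Humphreys1972, §5.1]
-/

noncomputable section

open scoped TensorProduct
open CategoryTheory Module

/-! ## Part A — the Lie step (abstract polarizable Hodge structures of weight one) -/

namespace Literature.AlgebraicGeometry.Motives

namespace HodgeStructure

open Literature.RepresentationTheory.GeneralLinear

universe u

/-! ### §1 `Θ` lies in the complexified derived algebra when it is trace-orthogonal to the centre -/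

section Derived

variable {V : Type u} [AddCommGroup V] [Module ℚ V] [Module.Finite ℚ V] {n : ℤ}

omit [Module.Finite ℚ V] in
/-- `(𝔞 ⊔ 𝔟)_ℂ = 𝔞_ℂ ⊔ 𝔟_ℂ` (extension of scalars is additive on subspaces). [folklore] -/
private theorem spanC_sup' (𝔞 𝔟 : Submodule ℚ (Module.End ℚ V)) : spanC (𝔞 ⊔ 𝔟) = spanC 𝔞 ⊔ spanC 𝔟 := by
  apply le_antisymm
  · unfold spanC
    rw [Submodule.span_le]
    rintro _ ⟨Z, hZ, rfl⟩
    obtain ⟨a, ha, b, hb, rfl⟩ := Submodule.mem_sup.1 hZ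
    change (a + b).baseChange ℂ ∈ _
    rw [LinearMap.baseChange_add]
    exact Submodule.add_mem_sup (baseChange_mem_spanC ha) (baseChange_mem_spanC hb)
  · unfold spanC
    exact sup_le (Submodule.span_mono (Set.image_mono fun Z hZ => Submodule.mem_sup_left hZ))
      (Submodule.span_mono (Set.image_mono fun Z hZ => Submodule.mem_sup_right hZ))

omit [Module.Finite ℚ V] in
/-- **`tr(D Z) = 0` for `D` in the derived algebra and `Z` commuting with `𝔤`**: `tr((XY - YX) Z) = tr(X (YZ - ZY)) = 0`.
[cite: Humphreys1972, §5.1] -/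
theorem trace_derived_mul_eq_zero_of_forall_commute [Module.Finite ℚ V] (𝔤 : Submodule ℚ (Module.End ℚ V))
    {Z : Module.End ℚ V} (hZc : ∀ Y ∈ 𝔤, Z * Y = Y * Z) {D : Module.End ℚ V}
    (hD : D ∈ Submodule.span ℚ {B | ∃ X ∈ 𝔤, ∃ Y ∈ 𝔤, X * Y - Y * X = B}) :
    LinearMap.trace ℚ V (D * Z) = 0 := by
  induction hD using Submodule.span_induction with
  | mem B hB =>
    obtain ⟨X, hX, Y, hY, rfl⟩ := hB
    rw [← trace_mul_commutator_eq, ← hZc Y hY, sub_self, mul_zero, map_zero]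
  | zero => rw [zero_mul, map_zero]
  | add B B' _ _ hB hB' => rw [add_mul, map_add, hB, hB', add_zero]
  | smul c B _ hB => rw [smul_mul_assoc, map_smul, hB, smul_zero]

omit [Module.Finite ℚ V] in
/-- Complexified form: `tr(s Z_ℂ) = 0` for `s ∈ 𝔡(𝔤)_ℂ` and `Z` commuting with `𝔤`. [cite: Humphreys1972, §5.1] -/
theorem trace_spanC_derived_mul_baseChange_eq_zero [Module.Finite ℚ V] (𝔤 : Submodule ℚ (Module.End ℚ V))
    {Z : Module.End ℚ V} (hZc : ∀ Y ∈ 𝔤, Z * Y = Y * Z) {s : Module.End ℂ (ℂ ⊗[ℚ] V)}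
    (hs : s ∈ spanC (Submodule.span ℚ {B | ∃ X ∈ 𝔤, ∃ Y ∈ 𝔤, X * Y - Y * X = B})) :
    LinearMap.trace ℂ _ (s * Z.baseChange ℂ) = 0 := by
  induction hs using Submodule.span_induction with
  | mem B hB =>
    obtain ⟨D, hD, rfl⟩ := hB
    change LinearMap.trace ℂ _ (D.baseChange ℂ * Z.baseChange ℂ) = 0
    rw [← LinearMap.baseChange_mul, LinearMap.trace_baseChange,
      trace_derived_mul_eq_zero_of_forall_commute 𝔤 hZc hD, map_zero]
  | zero => rw [zero_mul, map_zero]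
  | add B B' _ _ hB hB' => rw [add_mul, map_add, hB, hB', add_zero]
  | smul c B _ hB => rw [smul_mul_assoc, map_smul, hB, smul_zero]

variable [HodgeTensorFacts.{u, u}]

/-- **`Θ ∈ 𝔡(𝔤)_ℂ` when `Θ` is trace-orthogonal to the centre of `𝔤`** (effective weight one; `𝔤` bracket-closed,
rational, `ψ`-skew, `Θ ∈ 𝔤_ℂ`). Write `Θ = z + s` along `𝔤 = 𝔷(𝔤) ⊕ 𝔡(𝔤)` (`ThetaSubalgebra.center_sup_derived_eq`,
Deligne I 3.6 in Lie form); `s` is trace-orthogonal to `𝔷(𝔤)` (invariance of the trace form), hence so is `z`, and a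
non-zero `z ∈ 𝔷(𝔤)_ℂ` trace-orthogonal to `𝔷(𝔤)` would give (descent of radicals, `spanC_exists_rational_radical`)
a non-zero RATIONAL central `X` with `tr(X²) = 0`, against Hodge–Riemann (`trace_mul_self_lt_zero_of_central`). For
`𝔤 = Lie Hg(A)`: «`Hg(A)` semisimple ⟹ `h(U¹) ⊂ Hg(A)^{der}_ℝ`», the input of Lombardo's Lemma 3.2/3.4; Moonen–Zarhin's
criterion in Lie form. [cite: Lombardo2016, Lemma 3.4 (p. 1229)] [cite: MoonenZarhin1998WeilClasses, §1 Remark (1)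
after Criterion (2)] [cite: Deligne1982HodgeCycles, I §3 Prop. 3.6] -/
theorem theta_mem_spanC_derived_of_forall_central_trace_eq_zero (H : HodgeStructure V n) (hn : n = 1)
    (heff : H.IsEffective) (ψ : H.Polarization) (𝔤 : Submodule ℚ (Module.End ℚ V))
    (hbr : ∀ X ∈ 𝔤, ∀ Y ∈ 𝔤, X * Y - Y * X ∈ 𝔤)
    {Θ : Module.End ℂ (ℂ ⊗[ℚ] V)} (hΘ : ∀ p, ∀ x ∈ H.piece p (n - p), Θ x = ((2 * p - n : ℤ) : ℂ) • x)
    (hΘ𝔤 : Θ ∈ spanC 𝔤)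
    (hskew : ∀ X ∈ 𝔤, ∀ v w, ψ.form (X v) w + ψ.form v (X w) = 0)
    (htr : ∀ Z ∈ 𝔤, (∀ Y ∈ 𝔤, Z * Y = Y * Z) → LinearMap.trace ℂ _ (Θ * Z.baseChange ℂ) = 0) :
    Θ ∈ spanC (Submodule.span ℚ {B | ∃ X ∈ 𝔤, ∃ Y ∈ 𝔤, X * Y - Y * X = B}) := by
  classical
  set 𝔷 : Submodule ℚ (Module.End ℚ V) :=
    𝔤 ⊓ Subalgebra.toSubmodule (Subalgebra.centralizer ℚ (𝔤 : Set (Module.End ℚ V))) with h𝔷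
  set 𝔡 : Submodule ℚ (Module.End ℚ V) := Submodule.span ℚ {B | ∃ X ∈ 𝔤, ∃ Y ∈ 𝔤, X * Y - Y * X = B} with h𝔡
  have h𝔷mem : ∀ {Z}, Z ∈ 𝔷 ↔ Z ∈ 𝔤 ∧ ∀ Y ∈ 𝔤, Z * Y = Y * Z := fun {Z} =>
    Literature.Algebra.Lie.TraceSeparating.mem_center_iff 𝔤 Z
  -- `Θ = z + s` along `𝔤_ℂ = 𝔷_ℂ + 𝔡_ℂ`
  have hdec : 𝔷 ⊔ 𝔡 = 𝔤 := ThetaSubalgebra.center_sup_derived_eq H hn heff ψ 𝔤 hbr hΘ hΘ𝔤 hskew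
  have hΘ' : Θ ∈ spanC 𝔷 ⊔ spanC 𝔡 := by rw [← spanC_sup', hdec]; exact hΘ𝔤
  obtain ⟨z, hz, s, hs, hzs⟩ := Submodule.mem_sup.1 hΘ'
  -- `z` is trace-orthogonal to `𝔷`
  have hz_orth : ∀ Z' ∈ 𝔷, LinearMap.trace ℂ _ (z * Z'.baseChange ℂ) = 0 := by
    intro Z' hZ'
    obtain ⟨hZ'𝔤, hZ'c⟩ := h𝔷mem.1 hZ'
    have h1 := htr Z' hZ'𝔤 hZ'c
    rw [← hzs, add_mul, map_add, trace_spanC_derived_mul_baseChange_eq_zero 𝔤 hZ'c hs, add_zero] at h1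
    exact h1
  -- hence `z = 0` (descent of radicals + Hodge–Riemann on the centre)
  have hz0 : z = 0 := by
    by_contra hz0
    -- the trace form on `𝔷_ℂ`
    set τ : ↥(spanC 𝔷) →ₗ[ℂ] ↥(spanC 𝔷) →ₗ[ℂ] ℂ :=
      (((LinearMap.mul ℂ (Module.End ℂ (ℂ ⊗[ℚ] V))).compr₂ (LinearMap.trace ℂ (ℂ ⊗[ℚ] V))).compl₁₂
        (spanC 𝔷).subtype (spanC 𝔷).subtype) with hτ
    have hτapp : ∀ X Y : ↥(spanC 𝔷), τ X Y =
        LinearMap.trace ℂ _ ((X : Module.End ℂ (ℂ ⊗[ℚ] V)) * (Y : Module.End ℂ (ℂ ⊗[ℚ] V))) :=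
      fun X Y => rfl
    have hrat : ∀ (X : Module.End ℚ V) (hX : X ∈ 𝔷) (Y : Module.End ℚ V) (hY : Y ∈ 𝔷), ∃ q : ℚ,
        τ ⟨X.baseChange ℂ, baseChange_mem_spanC hX⟩ ⟨Y.baseChange ℂ, baseChange_mem_spanC hY⟩ = (q : ℂ) := by
      intro X hX Y hY
      refine ⟨LinearMap.trace ℚ V (X * Y), ?_⟩
      rw [hτapp]
      change LinearMap.trace ℂ _ (X.baseChange ℂ * Y.baseChange ℂ) = _
      rw [← LinearMap.baseChange_mul, LinearMap.trace_baseChange]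
      rfl
    have hrad : ∀ (Y : Module.End ℚ V) (hY : Y ∈ 𝔷),
        τ ⟨z, hz⟩ ⟨Y.baseChange ℂ, baseChange_mem_spanC hY⟩ = 0 := fun Y hY => by
      rw [hτapp]; exact hz_orth Y hY
    have hz0' : (⟨z, hz⟩ : ↥(spanC 𝔷)) ≠ 0 := fun h => hz0 (congrArg Subtype.val h)
    obtain ⟨X, hX, hX0, hXrad⟩ := spanC_exists_rational_radical 𝔷 τ hrat hz0' hrad
    obtain ⟨hX𝔤, hXc⟩ := h𝔷mem.1 hX
    have htrXX : LinearMap.trace ℚ V (X * X) = 0 := by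
      have h := hXrad ⟨X.baseChange ℂ, baseChange_mem_spanC hX⟩
      rw [hτapp] at h
      change LinearMap.trace ℂ _ (X.baseChange ℂ * X.baseChange ℂ) = 0 at h
      rw [← LinearMap.baseChange_mul, LinearMap.trace_baseChange] at h
      exact (algebraMap ℚ ℂ).injective (by rw [h, map_zero])
    exact hX0 (eq_zero_of_central_of_trace_mul_self_eq_zero H ψ 𝔤 hΘ hΘ𝔤 hskew hX𝔤 hXc htrXX)
  rw [hz0, zero_add] at hzs
  rw [← hzs]
  exact hs

/-- **`Θ ∈ 𝔡(𝔤)_ℂ` when `tr(Θ ∘ a_ℂ) = 0` for every `ψ`-skew CENTRAL HODGE ENDOMORPHISM `a` of `V`** (`𝔤` commuting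
with `End_Hdg(V)`; the centre of `𝔤` consists of such `a`, `mem_endAlg_and_commute_of_mem_center`). This is the
hypothesis the geometric layer supplies: for `V = H¹(A)`, `tr(Θ ∘ a) = tr(a | H^{1,0}) - tr(a | H^{0,1})` vanishes on
the centre of `End⁰(A)` iff the multiplicities of the centre on `Lie A` are balanced (`n_σ = n_σ̄`) iff `Hg(A)` is
semisimple (Moonen–Zarhin). [cite: MoonenZarhin1998WeilClasses, §1 Remark (1) after Criterion (2)]
[cite: Lombardo2016, Lemma 3.4 (p. 1229)] -/
theorem theta_mem_spanC_derived_of_forall_central_hodge_trace_eq_zero (H : HodgeStructure V n) (hn : n = 1)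
    (heff : H.IsEffective) (ψ : H.Polarization) (𝔤 : Submodule ℚ (Module.End ℚ V))
    (hbr : ∀ X ∈ 𝔤, ∀ Y ∈ 𝔤, X * Y - Y * X ∈ 𝔤)
    {Θ : Module.End ℂ (ℂ ⊗[ℚ] V)} (hΘ : ∀ p, ∀ x ∈ H.piece p (n - p), Θ x = ((2 * p - n : ℤ) : ℂ) • x)
    (hΘ𝔤 : Θ ∈ spanC 𝔤)
    (hcomm : ∀ X ∈ 𝔤, ∀ a : H.endAlg, X * (a : Module.End ℚ V) = (a : Module.End ℚ V) * X)
    (hskew : ∀ X ∈ 𝔤, ∀ v w, ψ.form (X v) w + ψ.form v (X w) = 0)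
    (hB : ∀ a ∈ H.endAlg, (∀ b ∈ H.endAlg, a * b = b * a) →
      (∀ v w, ψ.form (a v) w + ψ.form v (a w) = 0) → LinearMap.trace ℂ _ (Θ * a.baseChange ℂ) = 0) :
    Θ ∈ spanC (Submodule.span ℚ {B | ∃ X ∈ 𝔤, ∃ Y ∈ 𝔤, X * Y - Y * X = B}) :=
  theta_mem_spanC_derived_of_forall_central_trace_eq_zero H hn heff ψ 𝔤 hbr hΘ hΘ𝔤 hskew fun Z hZ hZc =>
    have h := mem_endAlg_and_commute_of_mem_center H 𝔤 hΘ hΘ𝔤 hcomm hZ hZc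
    hB Z h.1 h.2 (hskew Z hZ)

omit [Module.Finite ℚ V] [HodgeTensorFacts.{u, u}] in
/-- **«No factor of type IV» is the vacuous case**: if every `ψ`-skew central Hodge endomorphism of `V` vanishes
(the hypothesis `hE` of `HodgeThetaAnnihilatorPerfectTimesAbelian`), the `Θ`-trace condition holds trivially.
[cite: MoonenZarhin1999LowDim, §1] -/
theorem forall_central_hodge_trace_eq_zero_of_forall_central_skew_eq_zero (H : HodgeStructure V n)
    (ψ : H.Polarization) (Θ : Module.End ℂ (ℂ ⊗[ℚ] V))
    (hE : ∀ a ∈ H.endAlg, (∀ b ∈ H.endAlg, a * b = b * a) →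
      (∀ v w, ψ.form (a v) w + ψ.form v (a w) = 0) → a = 0) :
    ∀ a ∈ H.endAlg, (∀ b ∈ H.endAlg, a * b = b * a) →
      (∀ v w, ψ.form (a v) w + ψ.form v (a w) = 0) → LinearMap.trace ℂ _ (Θ * a.baseChange ℂ) = 0 := by
  intro a ha hc hs
  rw [hE a ha hc hs, LinearMap.baseChange_zero, mul_zero, map_zero]


omit [Module.Finite ℚ V] [HodgeTensorFacts.{u, u}] in
/-- **The `Θ`-TRACE CONDITION of a polarizable Hodge structure** (Lie form of «the Hodge group is
semisimple»; for `H¹` of an abelian variety of Weil type it is the balance `n_σ = n_σ̄` of Moonen–Zarhin):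
for every polarization `ψ`, the Hodge grading operator `Θ` (`= (2p - n)` on `V^{p,n-p}`) is trace-orthogonal
to every `ψ`-skew central Hodge endomorphism `a` of `V`: `tr(Θ ∘ a_ℂ) = 0`. (`Θ` is unique; the quantifier
over `Θ` only avoids naming it.) [cite: MoonenZarhin1998WeilClasses, §1 Remark (1) after Criterion (2)]
[cite: Deligne1982HodgeCycles, I §3 Prop. 3.6] -/
def ThetaTraceCondition (H : HodgeStructure V n) : Prop :=
  ∀ (ψ : H.Polarization) (Θ : Module.End ℂ (ℂ ⊗[ℚ] V)),
    (∀ p, ∀ x ∈ H.piece p (n - p), Θ x = ((2 * p - n : ℤ) : ℂ) • x) →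
    ∀ a ∈ H.endAlg, (∀ b ∈ H.endAlg, a * b = b * a) → (∀ v w, ψ.form (a v) w + ψ.form v (a w) = 0) →
      LinearMap.trace ℂ _ (Θ * a.baseChange ℂ) = 0

omit [Module.Finite ℚ V] [HodgeTensorFacts.{u, u}] in
/-- The `Θ`-trace condition holds (vacuously) when every `ψ`-skew central Hodge endomorphism vanishes for
every polarization `ψ` («no factor of type IV»). [cite: MoonenZarhin1999LowDim, §1] -/
theorem thetaTraceCondition_of_forall_central_skew_eq_zero (H : HodgeStructure V n)
    (hE : ∀ ψ : H.Polarization, ∀ a ∈ H.endAlg, (∀ b ∈ H.endAlg, a * b = b * a) →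
      (∀ v w, ψ.form (a v) w + ψ.form v (a w) = 0) → a = 0) : H.ThetaTraceCondition :=
  fun ψ Θ _ => forall_central_hodge_trace_eq_zero_of_forall_central_skew_eq_zero H ψ Θ (hE ψ)

end Derived

/-! ### §2 The product Lie step under the `Θ`-trace condition -/

section Main

variable {U V₁ V₂ : Type u} [AddCommGroup U] [Module ℚ U] [AddCommGroup V₁] [Module ℚ V₁]
  [AddCommGroup V₂] [Module ℚ V₂] [Module.Finite ℚ U] [Module.Finite ℚ V₁] [Module.Finite ℚ V₂]
  [HodgeTensorFacts.{u, u}] {n : ℤ}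
variable {M d m : ℕ}

omit [Module.Finite ℚ V₁] [HodgeTensorFacts.{u, u}] in
/-- **Bookkeeping**: an element of `𝔡(𝔤)_ℂ` lies in the `ℂ`-span of the commutators `X_ℂ X'_ℂ - X'_ℂ X_ℂ`,
`X, X' ∈ 𝔤` (base change is linear and multiplicative). [cite: Lombardo2016, Lemma 3.4 (p. 1229)] -/
theorem mem_span_commutators_baseChange_of_mem_spanC_derived {𝔤 : Submodule ℚ (Module.End ℚ V₁)}
    {Y : Module.End ℂ (ℂ ⊗[ℚ] V₁)}
    (hY : Y ∈ spanC (Submodule.span ℚ {B | ∃ X ∈ 𝔤, ∃ Y ∈ 𝔤, X * Y - Y * X = B})) :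
    Y ∈ Submodule.span ℂ {B | ∃ X ∈ 𝔤, ∃ X' ∈ 𝔤,
      X.baseChange ℂ * X'.baseChange ℂ - X'.baseChange ℂ * X.baseChange ℂ = B} := by
  induction hY using Submodule.span_induction with
  | mem Z hZ =>
    obtain ⟨D, hD, rfl⟩ := hZ
    refine Submodule.span_induction (p := fun X _ => X.baseChange ℂ ∈ Submodule.span ℂ
      {B | ∃ X ∈ 𝔤, ∃ X' ∈ 𝔤, X.baseChange ℂ * X'.baseChange ℂ - X'.baseChange ℂ * X.baseChange ℂ = B})
      ?_ ?_ ?_ ?_ hD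
    · rintro _ ⟨X₁, hX₁, X₂, hX₂, rfl⟩
      refine Submodule.subset_span ⟨X₁, hX₁, X₂, hX₂, ?_⟩
      rw [LinearMap.baseChange_sub, LinearMap.baseChange_mul, LinearMap.baseChange_mul]
    · rw [LinearMap.baseChange_zero]; exact Submodule.zero_mem _
    · intro X₁ X₂ _ _ h₁ h₂; rw [LinearMap.baseChange_add]; exact Submodule.add_mem _ h₁ h₂
    · intro c X₁ _ h₁
      rw [LinearMap.baseChange_smul]
      exact Submodule.smul_of_tower_mem _ c h₁
  | zero => exact Submodule.zero_mem _
  | add Z Z' _ _ hZ hZ' => exact Submodule.add_mem _ hZ hZ'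
  | smul c Z _ hZ => exact Submodule.smul_mem _ c hZ

/-- **Theorem (Lombardo 2016 Lemma 3.2/3.4 with `H(A)` semisimple / Moonen–Zarhin, Lie step, GENERAL form, in
the word model).** The product Lie step `exists_lie_wordDerAt_incl_proj_eq_zero_of_perfect_times_abelian` with
its hypothesis «every `ψ₁`-skew central Hodge endomorphism of `V₁` vanishes» (no factor of type IV) REPLACED by the
`Θ`-TRACE CONDITION `hB₁`: `tr(Θ₁ ∘ a_ℂ) = 0` for every `ψ₁`-skew central Hodge endomorphism `a` of `V₁` («`Hg(A)`
semisimple», e.g. `A` of Weil type with balanced signature `n_σ = n_σ̄`). Conclusion: a bracket-closed rational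
`𝔤₁ ⊆ 𝔰𝔭_{End_Hdg}(V₁, ψ₁)` with `Θ₁ ∈ 𝔤₁ ⊗ ℂ` AND `Θ₁ ∈ 𝔡(𝔤₁) ⊗ ℂ` such that the rational `Θ_U`-killed
coefficient tensor `q` is killed by the matrix of `ι₁ ∘ Y ∘ π₁` for every `Y ∈ 𝔡(𝔤₁) ⊗ ℂ` («`H(A × B)^{der} ↠
H(A)^{der} ∋ h(U¹)`»). Proof = the R5 proof verbatim (annihilator, `Θ_U ∈ 𝔞_ℂ`, Goursat step, corner algebra);
new last step `theta_mem_spanC_derived_of_forall_central_hodge_trace_eq_zero`.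
[cite: Lombardo2016, Lemma 3.4 (p. 1229)] [cite: MoonenZarhin1998WeilClasses, §1 Remark (1) after Criterion (2)]
[cite: MoonenZarhin1999LowDim, §1 and §3 (3.1)] [cite: Deligne1982HodgeCycles, I §3 Prop. 3.4 and Prop. 3.6] -/
theorem exists_lie_wordDerAt_incl_proj_eq_zero_of_thetaTrace_times_abelian (hn : n = 1) (HU : HodgeStructure U n)
    (H₁ : HodgeStructure V₁ n) (H₂ : HodgeStructure V₂ n) (heff₁ : H₁.IsEffective)
    {ι₁ : V₁ →ₗ[ℚ] U} {π₁ : U →ₗ[ℚ] V₁} {ι₂ : V₂ →ₗ[ℚ] U} {π₂ : U →ₗ[ℚ] V₂}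
    (hπι₁ : π₁ ∘ₗ ι₁ = LinearMap.id) (hπι₂ : π₂ ∘ₗ ι₂ = LinearMap.id) (hπ₁ι₂ : π₁ ∘ₗ ι₂ = 0)
    (hπ₂ι₁ : π₂ ∘ₗ ι₁ = 0) (hsum : ι₁ ∘ₗ π₁ + ι₂ ∘ₗ π₂ = LinearMap.id)
    (hι₁F : ∀ p, ∀ x ∈ H₁.piece p (n - p), ι₁.baseChange ℂ x ∈ HU.piece p (n - p))
    (hι₂F : ∀ p, ∀ x ∈ H₂.piece p (n - p), ι₂.baseChange ℂ x ∈ HU.piece p (n - p))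
    (ψ₁ : H₁.Polarization)
    {ιF : Type*} (aF₂ : ιF → H₂.endAlg)
    (hF₂ : ∀ Y Y' : Module.End ℚ V₂, (∀ f, Y * (aF₂ f : Module.End ℚ V₂) = (aF₂ f : Module.End ℚ V₂) * Y) →
      (∀ f, Y' * (aF₂ f : Module.End ℚ V₂) = (aF₂ f : Module.End ℚ V₂) * Y') → Y * Y' = Y' * Y)
    (eQ : Module.Basis (Fin M) ℚ U) (q : (Fin d → Fin m × Fin M) → ℚ)
    {ΘU : Module.End ℂ (ℂ ⊗[ℚ] U)} (hΘU : ∀ p, ∀ x ∈ HU.piece p (n - p), ΘU x = ((2 * p - n : ℤ) : ℂ) • x)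
    {Θ₁ : Module.End ℂ (ℂ ⊗[ℚ] V₁)} (hΘ₁ : ∀ p, ∀ x ∈ H₁.piece p (n - p), Θ₁ x = ((2 * p - n : ℤ) : ℂ) • x)
    (hB₁ : ∀ a ∈ H₁.endAlg, (∀ b ∈ H₁.endAlg, a * b = b * a) →
      (∀ v w, ψ₁.form (a v) w + ψ₁.form v (a w) = 0) → LinearMap.trace ℂ _ (Θ₁ * a.baseChange ℂ) = 0)
    (hΘq : ∀ u : Fin d → Fin m, wordDerAt ℂ (fun _ : Fin d =>
      LinearMap.toMatrix (Algebra.TensorProduct.basis ℂ eQ) (Algebra.TensorProduct.basis ℂ eQ) ΘU)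
      (wordSlice (fun w => algebraMap ℚ ℂ (q w)) u) = 0) :
    ∃ 𝔤₁ : Submodule ℚ (Module.End ℚ V₁),
      (∀ Y ∈ 𝔤₁, ∀ Y' ∈ 𝔤₁, Y * Y' - Y' * Y ∈ 𝔤₁) ∧
      (∀ Y ∈ 𝔤₁, ∀ a : H₁.endAlg, Y * (a : Module.End ℚ V₁) = (a : Module.End ℚ V₁) * Y) ∧
      (∀ Y ∈ 𝔤₁, ∀ v w, ψ₁.form (Y v) w + ψ₁.form v (Y w) = 0) ∧
      Θ₁ ∈ spanC 𝔤₁ ∧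
      Θ₁ ∈ spanC (Submodule.span ℚ {B | ∃ X ∈ 𝔤₁, ∃ Y ∈ 𝔤₁, X * Y - Y * X = B}) ∧
      ∀ Y ∈ spanC (Submodule.span ℚ {B | ∃ X ∈ 𝔤₁, ∃ Y ∈ 𝔤₁, X * Y - Y * X = B}), ∀ u : Fin d → Fin m,
        wordDerAt ℂ (fun _ : Fin d =>
          LinearMap.toMatrix (Algebra.TensorProduct.basis ℂ eQ) (Algebra.TensorProduct.basis ℂ eQ)
            (ι₁.baseChange ℂ ∘ₗ Y ∘ₗ π₁.baseChange ℂ))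
          (wordSlice (fun w => algebraMap ℚ ℂ (q w)) u) = 0 := by
  classical
  obtain ⟨Θ₂, hΘ₂⟩ := exists_hodgeTheta H₂
  have hΘ₁C : Θ₁ ∈ H₁.hodgeLieC := H₁.mem_hodgeLieC_of_forall_piece hΘ₁
  have hΘ₂C : Θ₂ ∈ H₂.hodgeLieC := H₂.mem_hodgeLieC_of_forall_piece hΘ₂
  have hsum' : ι₂ ∘ₗ π₂ + ι₁ ∘ₗ π₁ = LinearMap.id := by rw [add_comm]; exact hsum
  -- pointwise slot identities
  have e11 : ∀ v, π₁ (ι₁ v) = v := fun v => by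
    rw [← LinearMap.comp_apply (f := π₁), hπι₁, LinearMap.id_apply]
  have e22 : ∀ w, π₂ (ι₂ w) = w := fun w => by
    rw [← LinearMap.comp_apply (f := π₂), hπι₂, LinearMap.id_apply]
  -- `Θ` through the presentation
  have hΘι₁ := theta_incl_eq HU H₁ hι₁F hΘU hΘ₁
  have hΘι₂ := theta_incl_eq HU H₂ hι₂F hΘU hΘ₂
  have hΘπ₁ := proj_theta_eq HU H₁ H₂ hπι₁ hπ₁ι₂ hsum hι₁F hι₂F hΘU hΘ₁ hΘ₂
  have hΘπ₂ := proj_theta_eq HU H₂ H₁ hπι₂ hπ₂ι₁ hsum' hι₂F hι₁F hΘU hΘ₂ hΘ₁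
  -- the commuting family: `ι₁ a π₁` (`a ∈ End_Hdg V₁`), `ι₂ f π₂` (`f ∈ aF₂`), the two projectors
  set aF : (H₁.endAlg ⊕ ιF) ⊕ (Unit ⊕ Unit) → Module.End ℚ U :=
    Sum.elim (Sum.elim (fun a => ι₁ ∘ₗ (a : Module.End ℚ V₁) ∘ₗ π₁)
      (fun f => ι₂ ∘ₗ (aF₂ f : Module.End ℚ V₂) ∘ₗ π₂))
      (Sum.elim (fun _ => ι₁ ∘ₗ π₁) (fun _ => ι₂ ∘ₗ π₂)) with haF
  set φ : LinearMap.BilinForm ℚ U := ψ₁.form.compl₁₂ π₁ π₁ with hφ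
  set 𝔞 : Submodule ℚ (Module.End ℚ U) := annLie φ eQ aF q with h𝔞
  -- `Θ_U ∈ 𝔞_ℂ`
  have hΘ𝔞 : ΘU ∈ spanC 𝔞 := by
    refine mem_spanC_annLie φ eQ aF q hΘq (fun i => ?_) (fun x y => ?_)
    · apply LinearMap.ext
      intro y
      rcases i with (a | f) | (_ | _)
      · change ΘU ((ι₁ ∘ₗ (a : Module.End ℚ V₁) ∘ₗ π₁).baseChange ℂ y) =
          (ι₁ ∘ₗ (a : Module.End ℚ V₁) ∘ₗ π₁).baseChange ℂ (ΘU y)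
        simp only [LinearMap.baseChange_comp, LinearMap.comp_apply]
        rw [hΘι₁, ← Module.End.mul_apply (f := Θ₁), commute_baseChange_of_mem_hodgeLieC H₁ hΘ₁C a,
          Module.End.mul_apply, hΘπ₁]
      · change ΘU ((ι₂ ∘ₗ (aF₂ f : Module.End ℚ V₂) ∘ₗ π₂).baseChange ℂ y) =
          (ι₂ ∘ₗ (aF₂ f : Module.End ℚ V₂) ∘ₗ π₂).baseChange ℂ (ΘU y)
        simp only [LinearMap.baseChange_comp, LinearMap.comp_apply]
        rw [hΘι₂, ← Module.End.mul_apply (f := Θ₂), commute_baseChange_of_mem_hodgeLieC H₂ hΘ₂C (aF₂ f),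
          Module.End.mul_apply, hΘπ₂]
      · change ΘU ((ι₁ ∘ₗ π₁).baseChange ℂ y) = (ι₁ ∘ₗ π₁).baseChange ℂ (ΘU y)
        simp only [LinearMap.baseChange_comp, LinearMap.comp_apply]
        rw [hΘι₁, hΘπ₁]
      · change ΘU ((ι₂ ∘ₗ π₂).baseChange ℂ y) = (ι₂ ∘ₗ π₂).baseChange ℂ (ΘU y)
        simp only [LinearMap.baseChange_comp, LinearMap.comp_apply]
        rw [hΘι₂, hΘπ₂]
    · rw [hφ, baseChange_compl₁₂_apply, baseChange_compl₁₂_apply, hΘπ₁, hΘπ₁,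
        formBaseChange_skew_of_mem_hodgeLieC ψ₁ hΘ₁C, neg_add_cancel]
  -- what membership in `𝔞` gives
  have hmem : ∀ X ∈ 𝔞, (∀ i, X * aF i = aF i * X) ∧ ∀ v w, φ (X v) w + φ v (X w) = 0 :=
    fun X hX => ((mem_annLie_iff φ eQ aF q X).1 hX).2
  have hP₁ : ∀ X ∈ 𝔞, X * (ι₁ ∘ₗ π₁) = (ι₁ ∘ₗ π₁) * X := fun X hX => (hmem X hX).1 (Sum.inr (Sum.inl ()))
  have hP₂ : ∀ X ∈ 𝔞, X * (ι₂ ∘ₗ π₂) = (ι₂ ∘ₗ π₂) * X := fun X hX => (hmem X hX).1 (Sum.inr (Sum.inr ()))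
  have hTa : ∀ X ∈ 𝔞, ∀ a : H₁.endAlg, X * (ι₁ ∘ₗ (a : Module.End ℚ V₁) ∘ₗ π₁) =
      (ι₁ ∘ₗ (a : Module.End ℚ V₁) ∘ₗ π₁) * X := fun X hX a => (hmem X hX).1 (Sum.inl (Sum.inl a))
  have hTf : ∀ X ∈ 𝔞, ∀ f, X * (ι₂ ∘ₗ (aF₂ f : Module.End ℚ V₂) ∘ₗ π₂) =
      (ι₂ ∘ₗ (aF₂ f : Module.End ℚ V₂) ∘ₗ π₂) * X := fun X hX f => (hmem X hX).1 (Sum.inl (Sum.inr f))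
  -- the corners commute with `End_Hdg(V₁)` resp. `aF₂`
  have hc₁comm : ∀ X ∈ 𝔞, ∀ a : H₁.endAlg, (π₁ ∘ₗ X ∘ₗ ι₁) * (a : Module.End ℚ V₁) =
      (a : Module.End ℚ V₁) * (π₁ ∘ₗ X ∘ₗ ι₁) := by
    intro X hX a
    apply LinearMap.ext
    intro v
    have h := congrArg (fun f : Module.End ℚ U => π₁ (f (ι₁ v))) (hTa X hX a)
    simp only [Module.End.mul_apply, LinearMap.comp_apply, e11] at h
    simp only [Module.End.mul_apply, LinearMap.comp_apply]
    exact h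
  have hc₂comm : ∀ X ∈ 𝔞, ∀ f, (π₂ ∘ₗ X ∘ₗ ι₂) * (aF₂ f : Module.End ℚ V₂) =
      (aF₂ f : Module.End ℚ V₂) * (π₂ ∘ₗ X ∘ₗ ι₂) := by
    intro X hX f
    apply LinearMap.ext
    intro w
    have h := congrArg (fun g : Module.End ℚ U => π₂ (g (ι₂ w))) (hTf X hX f)
    simp only [Module.End.mul_apply, LinearMap.comp_apply, e22] at h
    simp only [Module.End.mul_apply, LinearMap.comp_apply]
    exact h
  have hc₁skew : ∀ X ∈ 𝔞, ∀ v w, ψ₁.form ((π₁ ∘ₗ X ∘ₗ ι₁) v) w + ψ₁.form v ((π₁ ∘ₗ X ∘ₗ ι₁) w) = 0 := by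
    intro X hX v w
    have h := (hmem X hX).2 (ι₁ v) (ι₁ w)
    rw [hφ, LinearMap.compl₁₂_apply, LinearMap.compl₁₂_apply, e11, e11] at h
    simpa only [LinearMap.comp_apply] using h
  -- the Goursat step inside `𝔞`
  have hbr𝔞 : ∀ X ∈ 𝔞, ∀ X' ∈ 𝔞,
      ι₁ ∘ₗ ((π₁ ∘ₗ X ∘ₗ ι₁) * (π₁ ∘ₗ X' ∘ₗ ι₁) - (π₁ ∘ₗ X' ∘ₗ ι₁) * (π₁ ∘ₗ X ∘ₗ ι₁)) ∘ₗ π₁ ∈ 𝔞 := by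
    intro X hX X' hX'
    rw [← bracket_eq_incl_corner_bracket_proj hπι₁ hπι₂ hsum (hP₁ X hX) (hP₂ X hX) (hP₁ X' hX') (hP₂ X' hX')
      (hF₂ _ _ (hc₂comm X hX) (hc₂comm X' hX'))]
    exact commutator_mem_annLie φ eQ aF q hX hX'
  -- the corner algebra `𝔤 = c₁(𝔞) ⊆ 𝔰𝔭_E(V₁, ψ₁)`
  obtain ⟨cLin, hcLin⟩ : ∃ L : Module.End ℚ U →ₗ[ℚ] Module.End ℚ V₁, ∀ X, L X = π₁ ∘ₗ X ∘ₗ ι₁ :=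
    ⟨{ toFun := fun X => π₁ ∘ₗ X ∘ₗ ι₁
       map_add' := fun X X' => by rw [LinearMap.add_comp, LinearMap.comp_add]
       map_smul' := fun c X => by rw [LinearMap.smul_comp, LinearMap.comp_smul, RingHom.id_apply] },
      fun X => rfl⟩
  set 𝔤 : Submodule ℚ (Module.End ℚ V₁) := 𝔞.map cLin with h𝔤
  have h𝔤mem : ∀ {Y}, Y ∈ 𝔤 ↔ ∃ X ∈ 𝔞, π₁ ∘ₗ X ∘ₗ ι₁ = Y := by
    intro Y
    rw [h𝔤, Submodule.mem_map]
    simp only [hcLin]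
  have hbr𝔤 : ∀ Y ∈ 𝔤, ∀ Y' ∈ 𝔤, Y * Y' - Y' * Y ∈ 𝔤 := by
    intro Y hY Y' hY'
    obtain ⟨X, hX, rfl⟩ := h𝔤mem.1 hY
    obtain ⟨X', hX', rfl⟩ := h𝔤mem.1 hY'
    refine h𝔤mem.2 ⟨_, hbr𝔞 X hX X' hX', ?_⟩
    apply LinearMap.ext
    intro v
    simp only [LinearMap.comp_apply, LinearMap.sub_apply, Module.End.mul_apply, e11]
  have hcomm𝔤 : ∀ Y ∈ 𝔤, ∀ a : H₁.endAlg, Y * (a : Module.End ℚ V₁) = (a : Module.End ℚ V₁) * Y := by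
    intro Y hY a
    obtain ⟨X, hX, rfl⟩ := h𝔤mem.1 hY
    exact hc₁comm X hX a
  have hskew𝔤 : ∀ Y ∈ 𝔤, ∀ v w, ψ₁.form (Y v) w + ψ₁.form v (Y w) = 0 := by
    intro Y hY v w
    obtain ⟨X, hX, rfl⟩ := h𝔤mem.1 hY
    exact hc₁skew X hX v w
  have hspanC𝔤 : spanC 𝔤 = Submodule.span ℂ
      ((fun X : Module.End ℚ U => (π₁ ∘ₗ X ∘ₗ ι₁).baseChange ℂ) '' (𝔞 : Set _)) := by
    rw [spanC, h𝔤, Submodule.map_coe, Set.image_image]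
    simp only [hcLin]
  -- `Θ₁ = c₁(Θ_U) ∈ 𝔤_ℂ`
  have hcorner : ∀ T ∈ spanC 𝔞, π₁.baseChange ℂ ∘ₗ T ∘ₗ ι₁.baseChange ℂ ∈ spanC 𝔤 := by
    intro T hT
    induction hT using Submodule.span_induction with
    | mem Z hZ =>
      obtain ⟨X, hX, rfl⟩ := hZ
      rw [← LinearMap.baseChange_comp, ← LinearMap.baseChange_comp]
      exact baseChange_mem_spanC (h𝔤mem.2 ⟨X, hX, rfl⟩)
    | zero => rw [LinearMap.zero_comp, LinearMap.comp_zero]; exact Submodule.zero_mem _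
    | add Z Z' _ _ hZ hZ' => rw [LinearMap.add_comp, LinearMap.comp_add]; exact Submodule.add_mem _ hZ hZ'
    | smul c Z _ hZ => rw [LinearMap.smul_comp, LinearMap.comp_smul]; exact Submodule.smul_mem _ c hZ
  have hΘ₁𝔤 : Θ₁ ∈ spanC 𝔤 := by
    have h : Θ₁ = π₁.baseChange ℂ ∘ₗ ΘU ∘ₗ ι₁.baseChange ℂ := by
      apply LinearMap.ext
      intro x
      rw [LinearMap.comp_apply, LinearMap.comp_apply, hΘι₁, proj_incl_baseChange hπι₁]
    rw [h]
    exact hcorner ΘU hΘ𝔞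
  -- brackets of elements of `𝔤_ℂ`, placed on `V₁`, lie in `𝔞_ℂ`
  have hD : ∀ Y ∈ spanC 𝔤, ∀ Y' ∈ spanC 𝔤,
      ι₁.baseChange ℂ ∘ₗ (Y * Y' - Y' * Y) ∘ₗ π₁.baseChange ℂ ∈ spanC 𝔞 := by
    intro Y hY Y' hY'
    rw [hspanC𝔤] at hY hY'
    exact incl_bracket_proj_mem_spanC 𝔞 hbr𝔞 hY hY'
  -- NEW LAST STEP: `Θ₁` lies in the complexified DERIVED corner algebra (the `Θ`-trace condition on `V₁`, §1)
  have hΘ₁𝔡 : Θ₁ ∈ spanC (Submodule.span ℚ {B | ∃ X ∈ 𝔤, ∃ Y ∈ 𝔤, X * Y - Y * X = B}) :=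
    theta_mem_spanC_derived_of_forall_central_hodge_trace_eq_zero H₁ hn heff₁ ψ₁ 𝔤 hbr𝔤 hΘ₁ hΘ₁𝔤 hcomm𝔤
      hskew𝔤 hB₁
  refine ⟨𝔤, hbr𝔤, hcomm𝔤, hskew𝔤, hΘ₁𝔤, hΘ₁𝔡, fun Y hY u => ?_⟩
  have hYmem : ι₁.baseChange ℂ ∘ₗ Y ∘ₗ π₁.baseChange ℂ ∈ spanC 𝔞 :=
    incl_comp_proj_mem_spanC_of_mem_span_commutators 𝔞 hD
      (mem_span_commutators_baseChange_of_mem_spanC_derived hY)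
  exact wordDerAt_eq_zero_of_mem_spanC_annLie φ eQ aF q hYmem u

/-- **Corollary (the shape the geometric consumer uses: `Y = Θ₁`).** Under the `Θ`-trace condition on `V₁` and
an abelian commutant on `V₂`, every rational coefficient tensor on `U = V₁ ⊕ V₂` killed by `Θ_U` is killed by
`ι₁ ∘ Θ₁ ∘ π₁` — «`Θ_A ⊕ 0 ∈ Lie Hg(A × B)_ℂ`: the tensor invariants of `Hg(A × B)` are invariant under the Hodge
circle of `A` alone» (Lombardo Lemma 3.4 with `H(A)` semisimple; for no-type-IV `A` this is the instance
`Y := Θ_A` of `wordDerAt_incl_proj_eq_zero_of_forall_lie` used by `HodgeTheory/NoTypeIVTimesCMInvariance`).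
[cite: Lombardo2016, Lemma 3.4 (p. 1229)] [cite: MoonenZarhin1999LowDim, §3 (3.1)] -/
theorem wordDerAt_incl_theta_proj_eq_zero_of_thetaTrace_times_abelian (hn : n = 1) (HU : HodgeStructure U n)
    (H₁ : HodgeStructure V₁ n) (H₂ : HodgeStructure V₂ n) (heff₁ : H₁.IsEffective)
    {ι₁ : V₁ →ₗ[ℚ] U} {π₁ : U →ₗ[ℚ] V₁} {ι₂ : V₂ →ₗ[ℚ] U} {π₂ : U →ₗ[ℚ] V₂}
    (hπι₁ : π₁ ∘ₗ ι₁ = LinearMap.id) (hπι₂ : π₂ ∘ₗ ι₂ = LinearMap.id) (hπ₁ι₂ : π₁ ∘ₗ ι₂ = 0)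
    (hπ₂ι₁ : π₂ ∘ₗ ι₁ = 0) (hsum : ι₁ ∘ₗ π₁ + ι₂ ∘ₗ π₂ = LinearMap.id)
    (hι₁F : ∀ p, ∀ x ∈ H₁.piece p (n - p), ι₁.baseChange ℂ x ∈ HU.piece p (n - p))
    (hι₂F : ∀ p, ∀ x ∈ H₂.piece p (n - p), ι₂.baseChange ℂ x ∈ HU.piece p (n - p))
    (ψ₁ : H₁.Polarization)
    {ιF : Type*} (aF₂ : ιF → H₂.endAlg)
    (hF₂ : ∀ Y Y' : Module.End ℚ V₂, (∀ f, Y * (aF₂ f : Module.End ℚ V₂) = (aF₂ f : Module.End ℚ V₂) * Y) →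
      (∀ f, Y' * (aF₂ f : Module.End ℚ V₂) = (aF₂ f : Module.End ℚ V₂) * Y') → Y * Y' = Y' * Y)
    (eQ : Module.Basis (Fin M) ℚ U) (q : (Fin d → Fin m × Fin M) → ℚ)
    {ΘU : Module.End ℂ (ℂ ⊗[ℚ] U)} (hΘU : ∀ p, ∀ x ∈ HU.piece p (n - p), ΘU x = ((2 * p - n : ℤ) : ℂ) • x)
    {Θ₁ : Module.End ℂ (ℂ ⊗[ℚ] V₁)} (hΘ₁ : ∀ p, ∀ x ∈ H₁.piece p (n - p), Θ₁ x = ((2 * p - n : ℤ) : ℂ) • x)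
    (hB₁ : ∀ a ∈ H₁.endAlg, (∀ b ∈ H₁.endAlg, a * b = b * a) →
      (∀ v w, ψ₁.form (a v) w + ψ₁.form v (a w) = 0) → LinearMap.trace ℂ _ (Θ₁ * a.baseChange ℂ) = 0)
    (hΘq : ∀ u : Fin d → Fin m, wordDerAt ℂ (fun _ : Fin d =>
      LinearMap.toMatrix (Algebra.TensorProduct.basis ℂ eQ) (Algebra.TensorProduct.basis ℂ eQ) ΘU)
      (wordSlice (fun w => algebraMap ℚ ℂ (q w)) u) = 0)
    (u : Fin d → Fin m) :
    wordDerAt ℂ (fun _ : Fin d =>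
      LinearMap.toMatrix (Algebra.TensorProduct.basis ℂ eQ) (Algebra.TensorProduct.basis ℂ eQ)
        (ι₁.baseChange ℂ ∘ₗ Θ₁ ∘ₗ π₁.baseChange ℂ))
      (wordSlice (fun w => algebraMap ℚ ℂ (q w)) u) = 0 := by
  obtain ⟨𝔤₁, -, -, -, -, hΘ𝔡, hkill⟩ :=
    exists_lie_wordDerAt_incl_proj_eq_zero_of_thetaTrace_times_abelian hn HU H₁ H₂ heff₁ hπι₁ hπι₂ hπ₁ι₂ hπ₂ι₁
      hsum hι₁F hι₂F ψ₁ aF₂ hF₂ eQ q hΘU hΘ₁ hB₁ hΘq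
  exact hkill Θ₁ hΘ𝔡 u

/-- **The no-type-IV theorem is the special case** (sanity link): under `hE₁` (every `ψ₁`-skew central Hodge
endomorphism of `V₁` vanishes) the `Θ`-trace condition holds vacuously, and the corollary gives back the instance
`Y := Θ₁` of `wordDerAt_incl_proj_eq_zero_of_forall_lie`. [cite: Lombardo2016, Lemma 3.4 (p. 1229)]
[cite: MoonenZarhin1999LowDim, §1 and §3 (3.1)] -/
theorem wordDerAt_incl_theta_proj_eq_zero_of_forall_central_skew_eq_zero (hn : n = 1) (HU : HodgeStructure U n)
    (H₁ : HodgeStructure V₁ n) (H₂ : HodgeStructure V₂ n) (heff₁ : H₁.IsEffective)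
    {ι₁ : V₁ →ₗ[ℚ] U} {π₁ : U →ₗ[ℚ] V₁} {ι₂ : V₂ →ₗ[ℚ] U} {π₂ : U →ₗ[ℚ] V₂}
    (hπι₁ : π₁ ∘ₗ ι₁ = LinearMap.id) (hπι₂ : π₂ ∘ₗ ι₂ = LinearMap.id) (hπ₁ι₂ : π₁ ∘ₗ ι₂ = 0)
    (hπ₂ι₁ : π₂ ∘ₗ ι₁ = 0) (hsum : ι₁ ∘ₗ π₁ + ι₂ ∘ₗ π₂ = LinearMap.id)
    (hι₁F : ∀ p, ∀ x ∈ H₁.piece p (n - p), ι₁.baseChange ℂ x ∈ HU.piece p (n - p))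
    (hι₂F : ∀ p, ∀ x ∈ H₂.piece p (n - p), ι₂.baseChange ℂ x ∈ HU.piece p (n - p))
    (ψ₁ : H₁.Polarization)
    (hE₁ : ∀ a ∈ H₁.endAlg, (∀ b ∈ H₁.endAlg, a * b = b * a) →
      (∀ v w, ψ₁.form (a v) w + ψ₁.form v (a w) = 0) → a = 0)
    {ιF : Type*} (aF₂ : ιF → H₂.endAlg)
    (hF₂ : ∀ Y Y' : Module.End ℚ V₂, (∀ f, Y * (aF₂ f : Module.End ℚ V₂) = (aF₂ f : Module.End ℚ V₂) * Y) →
      (∀ f, Y' * (aF₂ f : Module.End ℚ V₂) = (aF₂ f : Module.End ℚ V₂) * Y') → Y * Y' = Y' * Y)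
    (eQ : Module.Basis (Fin M) ℚ U) (q : (Fin d → Fin m × Fin M) → ℚ)
    {ΘU : Module.End ℂ (ℂ ⊗[ℚ] U)} (hΘU : ∀ p, ∀ x ∈ HU.piece p (n - p), ΘU x = ((2 * p - n : ℤ) : ℂ) • x)
    {Θ₁ : Module.End ℂ (ℂ ⊗[ℚ] V₁)} (hΘ₁ : ∀ p, ∀ x ∈ H₁.piece p (n - p), Θ₁ x = ((2 * p - n : ℤ) : ℂ) • x)
    (hΘq : ∀ u : Fin d → Fin m, wordDerAt ℂ (fun _ : Fin d =>
      LinearMap.toMatrix (Algebra.TensorProduct.basis ℂ eQ) (Algebra.TensorProduct.basis ℂ eQ) ΘU)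
      (wordSlice (fun w => algebraMap ℚ ℂ (q w)) u) = 0)
    (u : Fin d → Fin m) :
    wordDerAt ℂ (fun _ : Fin d =>
      LinearMap.toMatrix (Algebra.TensorProduct.basis ℂ eQ) (Algebra.TensorProduct.basis ℂ eQ)
        (ι₁.baseChange ℂ ∘ₗ Θ₁ ∘ₗ π₁.baseChange ℂ))
      (wordSlice (fun w => algebraMap ℚ ℂ (q w)) u) = 0 :=
  wordDerAt_incl_theta_proj_eq_zero_of_thetaTrace_times_abelian hn HU H₁ H₂ heff₁ hπι₁ hπι₂ hπ₁ι₂ hπ₂ι₁ hsum hι₁F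
    hι₂F ψ₁ aF₂ hF₂ eQ q hΘU hΘ₁
    (forall_central_hodge_trace_eq_zero_of_forall_central_skew_eq_zero H₁ ψ₁ Θ₁ hE₁) hΘq u

end Main

end HodgeStructure

end Literature.AlgebraicGeometry.Motives

end
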